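import Literature.Probability.RandomPlanarGeometry.CaratheodoryLC
import Literature.Probability.RandomPlanarGeometry.CaratheodoryHalfPlane
import HarnessLib

/-!
# Carathéodory's continuity theorem for Jordan domains, without the Jordan curve theorem

Trunk T-STOCH (complex analysis / plane topology). We **prove** the named fact
`Literature.Probability.RandomPlanarGeometry.JordanDomain.exists_continuousOn_closedBall_extension`
(`Literature/Probability/RandomPlanarGeometry/CaratheodoryHalfPlane.lean`; Pommerenke,
*Boundary Behaviour of Conformal Maps* (1992), Thm. 2.1, (ii) ⇒ (i)): a conformal equivalence
`φ` of the unit disc `𝔻` onto a Jordan domain `D` extends continuously to the closed disc —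

* `Literature.Probability.RandomPlanarGeometry.JordanDomain.exists_continuousOn_closedBall_extension_holds`.

This file is now a corollary of the general continuity theorem
`Literature.Probability.RandomPlanarGeometry.ConformalEquiv.continuousOn_extendFrom_of_lc` (`CaratheodoryLC.lean`, Pommerenke Thm. 2.1
(iv) ⇒ (i) under the uniform-continuum form of (iv), proved there from Wolff's length–area
lemma and Janiszewski's theorem, without the Jordan curve theorem): a Jordan domain satisfies
its hypothesis `hlc` — two nearby points of `∂D` lie on a short arc of the Jordan curve
(`D.exists_short_arc`), a continuum in `ℂ ∖ D` (`JordanDomain.hlc`). The intermediate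
statements of the first version (`image_inter_ball_subset_of_isPreconnected`,
`exists_forall_dist_lt'`, `exists_tendsto_of_norm_eq_one'`, `exists_tendsto_of_mem_closedBall'`,
`continuousOn_extendFrom'`) are kept, with unchanged statements, as one-line specialisations.

## References

* Ch. Pommerenke, *Boundary Behaviour of Conformal Maps*, Springer (1992), §1.1 (Janiszewski's
  theorem), Prop. 2.2, Thm. 2.1 and its proof p. 21.
-/

noncomputable section

open Set Filter Metric Topology Complex Real
open scoped NNReal

namespace Literature.Probability.RandomPlanarGeometry

namespace JordanDomain

open Literature.Analysis.Complex.LengthArea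

variable {D : JordanDomain} (φ : ConformalEquiv (ball (0 : ℂ) 1) D.carrier) {ζ : ℂ} {r : ℝ}

/-- The exterior `{R < dist z a}` of a closed disc is preconnected. [folklore] -/
theorem isPreconnected_setOf_lt_dist (a : ℂ) {R : ℝ} (hR : 0 ≤ R) :
    IsPreconnected {z : ℂ | R < dist z a} :=
  Literature.Probability.RandomPlanarGeometry.isPreconnected_setOf_lt_dist a hR

/-- **The near side of a short crosscut is small** (JCT-free form, via Janiszewski's theorem).
Let `C` be the crosscut `t ↦ φ (ζ - ζ r e^{it})`, `|t| < arccos (r/2)`, with endpoints `a, b`,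
let `σ ⊆ ∂D` be a compact preconnected set containing `a` and `b`, all contained in the closed
disc of radius `R` about `a`, and suppose `dist (φ 0) a > R`. Then `φ` maps
`𝔻 ∩ {|w - ζ| < r}` into that disc. Special case `G = D.carrier` (`σ ⊆ ∂D ⊆ ℂ ∖ D`) of
`ConformalEquiv.image_inter_ball_subset_of_subset_compl`. Pommerenke (1992), proof of Thm. 2.1
((iv) ⇒ (i)), with Janiszewski's theorem. [cite: PommerenkeBBCM1992, Thm. 2.1] -/
theorem image_inter_ball_subset_of_isPreconnected (hζ : ‖ζ‖ = 1) (hr : r ∈ Ioo (0 : ℝ) 1)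
    {a b : ℂ} (ha : Tendsto (fun t ↦ φ (cpt ζ r t)) (𝓝[>] (-arccos (r / 2))) (𝓝 a))
    (hb : Tendsto (fun t ↦ φ (cpt ζ r t)) (𝓝[<] (arccos (r / 2))) (𝓝 b))
    {σ : Set ℂ} (hσc : IsPreconnected σ) (hσK : IsCompact σ) (hσfr : σ ⊆ frontier D.carrier)
    (haσ : a ∈ σ) (hbσ : b ∈ σ) {R : ℝ}
    (hRc : ∀ t ∈ Ioo (-arccos (r / 2)) (arccos (r / 2)), dist (φ (cpt ζ r t)) a ≤ R)
    (hRσ : σ ⊆ closedBall a R) (hfar : R < dist (φ 0) a) :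
    φ '' (ball 0 1 ∩ ball ζ r) ⊆ closedBall a R :=
  ConformalEquiv.image_inter_ball_subset_of_subset_compl φ D.isOpen D.isBounded hζ hr ha hb hσc hσK
    (fun _ hx hxD ↦ D.not_mem_of_mem_frontier (hσfr hx) hxD) haσ hbσ hRc hRσ hfar

/-- **A Jordan domain has locally connected complement along its boundary** (hypothesis `hlc`
of `ConformalEquiv.continuousOn_extendFrom_of_lc`): two points of `∂D` at distance `< δ` lie on a
sub-arc of the Jordan curve of diameter `< ε` (`D.exists_short_arc`), which is a continuum in
`ℂ ∖ D`. Pommerenke (1992), Thm. 2.1, (ii) ⇒ (iii) ⇒ (iv). [cite: PommerenkeBBCM1992, Thm. 2.1] -/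
theorem hlc (D : JordanDomain) :
    ∀ ε > 0, ∃ δ > 0, ∀ a ∈ frontier D.carrier, ∀ b ∈ frontier D.carrier, dist a b < δ →
      ∃ σ ⊆ D.carrierᶜ, IsCompact σ ∧ IsPreconnected σ ∧ a ∈ σ ∧ b ∈ σ ∧ σ ⊆ closedBall a ε := by
  intro ε hε
  obtain ⟨δ, hδ, harc⟩ := D.exists_short_arc hε
  refine ⟨δ, hδ, fun a ha b hb hab ↦ ?_⟩
  obtain ⟨u, v, hu, hv, -, hσ⟩ := harc a ha b hb hab
  refine ⟨D.boundary '' uIcc u v, ?_, isCompact_uIcc.image D.continuous_boundary,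
    isPreconnected_uIcc.image _ D.continuous_boundary.continuousOn, ⟨u, left_mem_uIcc, hu⟩,
    ⟨v, right_mem_uIcc, hv⟩, ?_⟩
  · rintro _ ⟨s, -, rfl⟩ hsD
    refine D.not_mem_of_mem_frontier ?_ hsD
    rw [D.frontier_eq_range]
    exact mem_range_self s
  · rintro _ ⟨s, hs, rfl⟩
    exact mem_closedBall.2 (hσ s hs).le

/-- **Equicontinuity at a boundary point**, JCT-free: for every `ε₀ > 0` there is `ρ > 0` such
that `φ` oscillates by less than `ε₀` on `𝔻 ∩ {|w - ζ| < ρ}` (short crosscut by length–area,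
short boundary arc between its endpoints, `image_inter_ball_subset_of_isPreconnected`).
Pommerenke (1992), proof of Thm. 2.1. [cite: PommerenkeBBCM1992, Thm. 2.1] -/
theorem exists_forall_dist_lt' (hζ : ‖ζ‖ = 1) {ε₀ : ℝ} (hε₀ : 0 < ε₀) :
    ∃ ρ > 0, ∀ z ∈ ball (0 : ℂ) 1, dist z ζ < ρ → ∀ z' ∈ ball (0 : ℂ) 1, dist z' ζ < ρ →
      dist (φ z) (φ z') < ε₀ :=
  ConformalEquiv.exists_forall_dist_lt_of_lc φ D.isOpen D.isBounded (hlc D) hζ hε₀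

/-- `φ` has a limit at every point of the unit circle from within the disc (JCT-free). [cite: PommerenkeBBCM1992, Thm. 2.1] -/
theorem exists_tendsto_of_norm_eq_one' (hζ : ‖ζ‖ = 1) :
    ∃ y, Tendsto φ (𝓝[ball 0 1] ζ) (𝓝 y) :=
  ConformalEquiv.exists_tendsto_of_lc φ D.isOpen D.isBounded (hlc D) (mem_closedBall_zero_iff.2 hζ.le)

/-- `φ` has a limit within the disc at every point of the closed disc (JCT-free). [cite: PommerenkeBBCM1992, Thm. 2.1] -/
theorem exists_tendsto_of_mem_closedBall' {x : ℂ} (hx : x ∈ closedBall (0 : ℂ) 1) :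
    ∃ y, Tendsto φ (𝓝[ball 0 1] x) (𝓝 y) :=
  ConformalEquiv.exists_tendsto_of_lc φ D.isOpen D.isBounded (hlc D) hx

/-- **Carathéodory's continuity theorem** (Pommerenke (1992), Thm. 2.1, (ii) ⇒ (i)), JCT-free:
`extendFrom 𝔻 φ` is continuous on the closed disc. [cite: PommerenkeBBCM1992, Thm. 2.1] -/
theorem continuousOn_extendFrom' :
    ContinuousOn (extendFrom (ball 0 1) φ) (closedBall (0 : ℂ) 1) :=
  (ConformalEquiv.continuousOn_extendFrom_of_lc φ D.isOpen D.isBounded (hlc D)).1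

/-- **`Literature.Probability.RandomPlanarGeometry.JordanDomain.exists_continuousOn_closedBall_extension` holds**: a conformal
equivalence of the unit disc onto a Jordan domain extends continuously to the closed disc
(Pommerenke (1992), Thm. 2.1, (ii) ⇒ (i)), proved from Wolff's length–area lemma and
Janiszewski's theorem, without the Jordan curve theorem. [cite: PommerenkeBBCM1992, Thm. 2.1] -/
theorem exists_continuousOn_closedBall_extension_holds : exists_continuousOn_closedBall_extension :=
  fun _ ψ ↦ ⟨extendFrom (ball 0 1) ψ, continuousOn_extendFrom' ψ, fun _ hx ↦ extendFrom_eq ψ hx⟩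

end JordanDomain

end Literature.Probability.RandomPlanarGeometry
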